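import Mathlib
import Summits.Ventures.PercRepro2.HCov
import Summits.Ventures.PercRepro2.GcTransport
import Summits.Ventures.PercRepro2.GcHatConn
import Summits.Ventures.PercRepro2.GcHatConnPattern
import Summits.Ventures.PercRepro2.GcHatPush
import Summits.Ventures.PercRepro2.GcTransportScaled

/-!
# The hat and the root pair as scaled transports (blind cell PercRepro2, typer-1 g57)

The two `Q`-killed reductions landed mass by mass (`Hat.Gc_hat`, `RootPair.Gc_rootPair`) are
instances of `Scale.Gc_scale` (`GcTransportScaled.lean`):

* **`isScaledTransport_hat`** — the hat map with the admissible sets `HatG e₁ e₂` / `HatG e₂ e₃`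
  and the constant `hatC` (`Hat.prob_hat_pushforward`, `Hat.conn_hatGraph_iff`);
  **`Gc_hat_of_scale`** = `Hat.Gc_hat`;
* **`isScaledTransport_rootPair`** — for `e = {a₁, a₂}` the identity map with `G = {e closed}`,
  `G' = univ`, `c = 1 − p_e`, the target `e` re-routed to a loop (`prob_inter_closedEdge`,
  `RECM.conn_update_false_iff_loop`); **`Gc_rootPair_of_scale`** = `RootPair.Gc_rootPair` in its
  looped form.

What a reduction of this kind has to supply is its pushforward identity and its connectivity
agreement on the admissible configurations; `Gc_scale` does the rest. Standard axioms.
-/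

namespace Summit.Ventures.PercRepro2

open CovForm

namespace Scale

section Instances

variable {V : Type*} {E : Type*} [Fintype E] [DecidableEq E] [DecidableEq V] {R : Type*} [Field R]

/-- **The hat is a scaled transport** (`Hat.prob_hat_pushforward`, `Hat.conn_hatGraph_iff`): the
hat map with the admissible sets `HatG e₁ e₂` / `HatG e₂ e₃`, the constant `hatC`, on the
vertices other than `u`. -/
theorem isScaledTransport_hat {ends : E → Sym2 V} {u a₁ a₂ w : V} {e₁ e₂ e₃ : E}
    (h : Hat.IsHatAt ends u a₁ a₂ w e₁ e₂ e₃) (p : E → R) (hN : Hat.hatN p e₁ e₂ e₃ ≠ 0)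
    (hAN : Hat.hatA p e₁ e₂ e₃ + Hat.hatN p e₁ e₂ e₃ ≠ 0)
    (hBN : Hat.hatB p e₁ e₂ e₃ + Hat.hatN p e₁ e₂ e₃ ≠ 0) :
    IsScaledTransport p (Hat.hatWeights p e₁ e₂ e₃) ends (Hat.hatGraph ends a₁ a₂ w e₁ e₂ e₃)
      (Hat.hatMap e₁ e₂ e₃) (Hat.HatG e₁ e₂) (Hat.HatG e₂ e₃) (Hat.hatC p e₁ e₂ e₃) a₁ a₂
      {x | x ≠ u} where
  push Y := Hat.prob_hat_pushforward h.e12 h.e13 h.e23 p hN hAN hBN Y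
  memG ω hc := Hat.mem_HatG_of_not_conn h hc
  memG' ω hc := by
    by_contra hω
    exact hc (Hat.conn_roots_hat_of_not_mem_HatG h hω)
  conn ω hω x hx z hz := Hat.conn_hatGraph_iff h hω hx hz
  mem₁ := h.ua1.symm
  mem₂ := h.ua2.symm

/-- **`Hat.Gc_hat` from `Gc_scale`**: `Gc p ends = hatC³ · Gc (hatWeights p) (hatGraph ends)`. -/
theorem Gc_hat_of_scale [LinearOrder R] [IsStrictOrderedRing R] {ends : E → Sym2 V}
    {u a₁ a₂ w : V} {e₁ e₂ e₃ : E} (h : Hat.IsHatAt ends u a₁ a₂ w e₁ e₂ e₃) (p : E → R) (hN : Hat.hatN p e₁ e₂ e₃ ≠ 0)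
    (hAN : Hat.hatA p e₁ e₂ e₃ + Hat.hatN p e₁ e₂ e₃ ≠ 0)
    (hBN : Hat.hatB p e₁ e₂ e₃ + Hat.hatN p e₁ e₂ e₃ ≠ 0) {o a₃ b : V} (huo : o ≠ u)
    (hu3 : a₃ ≠ u) (hub : b ≠ u) :
    Gc p ends o a₁ a₂ a₃ b = Hat.hatC p e₁ e₂ e₃ ^ 3 *
      Gc (Hat.hatWeights p e₁ e₂ e₃) (Hat.hatGraph ends a₁ a₂ w e₁ e₂ e₃) o a₁ a₂ a₃ b :=
  Gc_scale (isScaledTransport_hat h p hN hAN hBN) huo hu3 hub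

omit [DecidableEq V] in
/-- The closed-edge pushforward: pinning `e` closed is the scaled pushforward of the identity map
with the admissible set `{e closed}` and the constant `1 − p_e` (`prob_inter_closedEdge`). -/
lemma prob_closedEdge_push (p : E → R) (e : E) (Y : Set (Config E)) :
    prob p (id ⁻¹' Y ∩ closedEdge e) = (1 - p e) * prob (Function.update p e 0) (Y ∩ Set.univ) := by
  simp only [Set.preimage_id, Set.inter_univ]
  exact prob_inter_closedEdge p Y e

omit [Fintype E] [DecidableEq V] in
/-- On `{e closed}` the connectivity agrees with that of the graph in which `e` is re-routed to a
loop at `v`. -/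
lemma conn_closedEdge_loop_iff (ends : E → Sym2 V) (e : E) (v : V) {ω : Config E}
    (hω : ω ∈ closedEdge e) (x z : V) :
    Conn ends ω x z ↔ Conn (Function.update ends e s(v, v)) ω x z := by
  have h := RECM.conn_update_false_iff_loop ends e v ω x z
  have hf0 : ω e = false := hω
  have hωe : Function.update ω e false = ω := by
    ext f
    by_cases hf : f = e
    · subst hf; simp [hf0]
    · simp [Function.update_of_ne hf]
  rw [hωe] at h
  exact h

omit [DecidableEq V] in
/-- **The root pair is a scaled transport** (`e = {a₁, a₂}`): the identity map, `G = {e closed}`,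
`G' = univ`, `c = 1 − p_e`, the target `e` re-routed to a loop at `a₁`, on all vertices. -/
theorem isScaledTransport_rootPair {ends : E → Sym2 V} {e : E} {a₁ a₂ : V}
    (he : ends e = s(a₁, a₂)) (p : E → R) :
    IsScaledTransport p (Function.update p e 0) ends (Function.update ends e s(a₁, a₁)) id
      (closedEdge e) Set.univ (1 - p e) a₁ a₂ Set.univ where
  push Y := prob_closedEdge_push p e Y
  memG ω hc := by
    by_contra hω
    have hopen : ω e = true := by
      cases hh : ω e
      · exact absurd (mem_closedEdge.2 hh) hω
      · rfl
    exact hc (RECM.conn_ends_of_open he hopen)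
  memG' _ _ := Set.mem_univ _
  conn ω hω x _ z _ := conn_closedEdge_loop_iff ends e a₁ hω x z
  mem₁ := Set.mem_univ _
  mem₂ := Set.mem_univ _

omit [DecidableEq V] in
/-- **`RootPair.Gc_rootPair` from `Gc_scale`**, in its looped form: `Gc p ends = (1 − p_e)³ ·
Gc (p[e ↦ 0]) (ends[e ↦ loop])` for `e = {a₁, a₂}`. -/
theorem Gc_rootPair_of_scale [LinearOrder R] [IsStrictOrderedRing R] {ends : E → Sym2 V} {e : E}
    {a₁ a₂ : V} (he : ends e = s(a₁, a₂)) (p : E → R) (o a₃ b : V) :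
    Gc p ends o a₁ a₂ a₃ b = (1 - p e) ^ 3 *
      Gc (Function.update p e 0) (Function.update ends e s(a₁, a₁)) o a₁ a₂ a₃ b :=
  Gc_scale (isScaledTransport_rootPair he p) (Set.mem_univ o) (Set.mem_univ a₃) (Set.mem_univ b)

end Instances

end Scale

end Summit.Ventures.PercRepro2
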